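import Mathlib
import HarnessLib
import Summits.Ventures.LatticeQCDFlow.Exactness.NCPLayerEquiv
import Summits.Ventures.LatticeQCDFlow.Exactness.GaugeFTHMCLeapfrog

/-!
# FT-HMC on the U(1) rung exactly as the engine runs it, through its certified members: degree-one coupling layers, the NCP flows, lists of layers

HONEST FRAMING: exact (Metropolis-corrected) sampling algorithms for lattice gauge theory;
figures of merit are autocorrelation/cost numbers at stated couplings and volumes; no
continuum-physics claim.

Venture `LatticeQCDFlow` (cell pub-lqcd), topic `Exactness`; FANOUT row 14 (`eng-flowhmc`, engine
`latflow.fthmc`).  NEW WORK of the cell: the three corollaries that put together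
`GaugeFTHMCLeapfrog.u1_fthmc_leapfrog_gaussian_exact` (refresh Gaussian momenta → leapfrog^n with
the link drift `V_i ← e^{i c p_i} V_i` and ANY measurable force → flip → Metropolis on the
pulled-back Hamiltonian → forget → report through the member, on `ι → U(1)` with product Haar
probability) with the members certified in `DegreeOneLayerEquiv` (any `C¹` degree-one coupling
layer), `NCPLayerEquiv` (the NCP-mixture layers of the U(1) flows; lists of certified layers) and
`CircleGroupJacobian` (their Jacobians).  Nothing is cited as a fact; no number.

## Content

* **`u1_fthmc_leapfrog_gaussian_exact_of_degreeOne`** — the engine's update through a `C¹`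
  degree-one U(1) coupling layer `F = coupleEquiv ψ …` with `J = coupleJac = ∏_active Φ'` leaves
  `e^{−S}·Haar^ι` invariant, for every measurable action `S`, drift coefficient `c`, measurable
  force `g` and trajectory length `n`;
* **`u1_fthmc_leapfrog_gaussian_exact_ncpMixture`** — the same for the NCP-mixture layers
  (Kanwar et al. 2020; weights, scales, offsets, shift measurable in the frozen links);
* **`u1_fthmc_leapfrog_gaussian_exact_foldr`** — the same for a member given as a LIST of
  certified layers (composite map, running-product Jacobian).

NOT here: ergodicity; SU(N); any number.
-/

noncomputable section

namespace Summit.Ventures.LatticeQCDFlow.Exactness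

open Set Function MeasureTheory Filter Summit.Ventures.LatticeQCDFlow.Theory2
open ProbabilityTheory ProbabilityTheory.Kernel
open Literature.MathematicalPhysics.QuantumFieldTheory (haarProbability)
open scoped NNReal ENNReal Topology

section Layers

variable {ι : Type*} [Fintype ι] {p : ι → Prop} [DecidablePred p]

/-- **FT-HMC as `latflow.fthmc` runs it, through any `C¹` degree-one U(1) coupling layer, is
exact.**  Lifts `Φ a y` (`C¹`, `Φ' > 0` continuous, degree one, jointly measurable in the frozen
links together with `Φ'`); the layer `F = coupleEquiv ψ …` (`ψ a y (e^{iθ}) = e^{iΦ a y θ}`, e.g.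
from `exists_coupleEquiv_of_hasDerivAt_pos`) with `jac a y (e^{iθ}) = Φ' a y θ`; refresh
`π ∼ N(0, 1)^ι` → leapfrog^n (`V_i ← e^{i c π_i} V_i`, `π ← π + g V` with ANY measurable `g`) →
flip → accept on `ΔH̃`, `H̃ = (S ∘ F − log coupleJac) + Σ π_i²/2` → forget `π` → report `F V`:
the configuration kernel leaves `e^{−S}·Haar^ι` invariant. -/
theorem u1_fthmc_leapfrog_gaussian_exact_of_degreeOne
    {Φ Φ' : {i // p i} → ({i // ¬p i} → Circle) → ℝ → ℝ}
    (hderiv : ∀ a y θ, HasDerivAt (Φ a y) (Φ' a y θ) θ) (hcont : ∀ a y, Continuous (Φ' a y))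
    (hpos : ∀ a y θ, 0 < Φ' a y θ) (hdeg : ∀ a y θ, Φ a y (θ + 2 * Real.pi) = Φ a y θ + 2 * Real.pi)
    (hΦm : ∀ a, Measurable fun w : ℝ × ({i // ¬p i} → Circle) => Φ a w.2 w.1)
    (hΦ'm : ∀ a, Measurable fun w : ℝ × ({i // ¬p i} → Circle) => Φ' a w.2 w.1)
    (ψ : {i // p i} → ({i // ¬p i} → Circle) → Circle ≃ᵐ Circle)
    (hψ : ∀ a y (θ : ℝ), ψ a y (Circle.exp θ) = Circle.exp (Φ a y θ))
    (hψm : ∀ a, Measurable fun q : Circle × ({i // ¬p i} → Circle) => ψ a q.2 q.1)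
    (hψsm : ∀ a, Measurable fun q : Circle × ({i // ¬p i} → Circle) => (ψ a q.2).symm q.1)
    {jac : {i // p i} → ({i // ¬p i} → Circle) → Circle → ℝ}
    (hjac : ∀ a y (θ : ℝ), jac a y (Circle.exp θ) = Φ' a y θ)
    {S : (ι → Circle) → ℝ} (hS : Measurable S) (c : ℝ) {g : (ι → Circle) → (ι → ℝ)}
    (hg : Measurable g) (n : ℕ) :
    Invariant
      (conjKernel
        (refreshUpdate
          (involMH
            (⇑((flip : Equiv.Perm ((ι → Circle) × (ι → ℝ))) *
                leapfrog (mulDrift fun q : ι → ℝ => fun i => Circle.exp (c * q i)) g ^ n))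
            (measurable_flip_leapfrog_pow (measurable_mulDrift (measurable_circleDrift c)) hg n)
            fun z : (ι → Circle) × (ι → ℝ) =>
              (S (coupleEquiv ψ hψm hψsm z.1) - Real.log (coupleJac p jac z.1)) +
                ∑ i, z.2 i ^ 2 / 2)
          ((((volume : Measure (ι → ℝ)).withDensity
                fun q => ENNReal.ofReal (Real.exp (-(∑ i, q i ^ 2 / 2)))) Set.univ)⁻¹ •
            (volume : Measure (ι → ℝ)).withDensity
              fun q => ENNReal.ofReal (Real.exp (-(∑ i, q i ^ 2 / 2)))))
        (coupleEquiv ψ hψm hψsm))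
      ((Measure.pi fun _ : ι => haarProbability Circle).withDensity
        fun U => ENNReal.ofReal (Real.exp (-S U))) := by
  -- per-link factor: positive at every point of `U(1)`, jointly measurable
  have hj0 : ∀ a y u, 0 < jac a y u := fun a y u => by
    obtain ⟨θ, rfl⟩ := Circle.exp_surjective u
    rw [hjac]
    exact hpos a y θ
  have hjm : ∀ a, Measurable fun q : Circle × ({i // ¬p i} → Circle) => jac a q.2 q.1 := fun a => by
    refine Circle.measurable_of_measurable_comp_exp_prod ?_
    simp_rw [hjac]
    exact hΦ'm a
  have hF : HasJacobian (Measure.pi fun _ : ι => haarProbability Circle)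
      (coupleEquiv ψ hψm hψsm) fun U => ENNReal.ofReal (coupleJac p jac U) :=
    hasJacobian_coupleFun_circleGroup_of_degreeOne hderiv hcont hpos hdeg hΦm hΦ'm
      (ψ := fun a y u => ψ a y u) hψ hjac
  exact u1_fthmc_leapfrog_gaussian_exact (F := coupleEquiv ψ hψm hψsm) (J := coupleJac p jac)
    (fun U => coupleJac_pos hj0 U) (measurable_coupleJac hjm) hF hS c hg n

variable {m : ℕ}

/-- **FT-HMC as `latflow.fthmc` runs it, through a U(1) coupling layer of NCP mixtures, is
exact** (the engine's `u1-flow-trained` member, one layer): weights `w b y ≥ 0` summing to one,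
scales `l b y > 0`, offsets `a b y`, shift `t b y` measurable in the frozen links; `ψ` any family
realising the mixture (e.g. `exists_coupleEquiv_ncpMixture`), `jac` the mixture Jacobian; the
rest as in `u1_fthmc_leapfrog_gaussian_exact_of_degreeOne`. -/
theorem u1_fthmc_leapfrog_gaussian_exact_ncpMixture
    (w a l : {i // p i} → ({i // ¬p i} → Circle) → Fin m → ℝ)
    (t : {i // p i} → ({i // ¬p i} → Circle) → ℝ)
    (hw : ∀ b i, Measurable fun y => w b y i) (ha : ∀ b i, Measurable fun y => a b y i)
    (hlm : ∀ b i, Measurable fun y => l b y i) (ht : ∀ b, Measurable (t b))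
    (hw0 : ∀ b y i, 0 ≤ w b y i) (hw1 : ∀ b y, ∑ i, w b y i = 1) (hl : ∀ b y i, 0 < l b y i)
    (ψ : {i // p i} → ({i // ¬p i} → Circle) → Circle ≃ᵐ Circle)
    (hψ : ∀ b y (θ : ℝ), ψ b y (Circle.exp θ) = Circle.exp (t b y + ∑ i, w b y i * (a b y i +
      ((θ - a b y i) + 2 * Real.arctan ((l b y i - 1) * Real.sin (θ - a b y i) /
        ((1 + l b y i) + (1 - l b y i) * Real.cos (θ - a b y i)))))))
    (hψm : ∀ b, Measurable fun q : Circle × ({i // ¬p i} → Circle) => ψ b q.2 q.1)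
    (hψsm : ∀ b, Measurable fun q : Circle × ({i // ¬p i} → Circle) => (ψ b q.2).symm q.1)
    {jac : {i // p i} → ({i // ¬p i} → Circle) → Circle → ℝ}
    (hjac : ∀ b y (θ : ℝ), jac b y (Circle.exp θ) =
      ∑ i, w b y i * (2 * l b y i /
        ((1 + l b y i ^ 2) + (1 - l b y i ^ 2) * Real.cos (θ - a b y i))))
    {S : (ι → Circle) → ℝ} (hS : Measurable S) (c : ℝ) {g : (ι → Circle) → (ι → ℝ)}
    (hg : Measurable g) (n : ℕ) :
    Invariant
      (conjKernel
        (refreshUpdate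
          (involMH
            (⇑((flip : Equiv.Perm ((ι → Circle) × (ι → ℝ))) *
                leapfrog (mulDrift fun q : ι → ℝ => fun i => Circle.exp (c * q i)) g ^ n))
            (measurable_flip_leapfrog_pow (measurable_mulDrift (measurable_circleDrift c)) hg n)
            fun z : (ι → Circle) × (ι → ℝ) =>
              (S (coupleEquiv ψ hψm hψsm z.1) - Real.log (coupleJac p jac z.1)) +
                ∑ i, z.2 i ^ 2 / 2)
          ((((volume : Measure (ι → ℝ)).withDensity
                fun q => ENNReal.ofReal (Real.exp (-(∑ i, q i ^ 2 / 2)))) Set.univ)⁻¹ •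
            (volume : Measure (ι → ℝ)).withDensity
              fun q => ENNReal.ofReal (Real.exp (-(∑ i, q i ^ 2 / 2)))))
        (coupleEquiv ψ hψm hψsm))
      ((Measure.pi fun _ : ι => haarProbability Circle).withDensity
        fun U => ENNReal.ofReal (Real.exp (-S U))) :=
  u1_fthmc_leapfrog_gaussian_exact_of_degreeOne
    (Φ := fun b y θ => t b y + ∑ i, w b y i * (a b y i + ((θ - a b y i) +
      2 * Real.arctan ((l b y i - 1) * Real.sin (θ - a b y i) /
        ((1 + l b y i) + (1 - l b y i) * Real.cos (θ - a b y i))))))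
    (Φ' := fun b y θ => ∑ i, w b y i *
      (2 * l b y i / ((1 + l b y i ^ 2) + (1 - l b y i ^ 2) * Real.cos (θ - a b y i))))
    (fun b y => hasDerivAt_mixture (w b y) (a b y) (t b y) fun i θ => hasDerivAt_ncpLift (hl b y i) θ)
    (fun b y => continuous_finsetSum _ fun i _ => continuous_const.mul
      ((continuous_ncpJac (hl b y i)).comp (continuous_id.sub continuous_const)))
    (fun b y => mixture_deriv_pos (w b y) (a b y) (hw0 b y) (hw1 b y) fun i θ => ncpJac_pos (hl b y i) θ)
    (fun b y => mixture_add_two_pi (w b y) (a b y) (t b y)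
      (Φ := fun i θ => θ + 2 * Real.arctan ((l b y i - 1) * Real.sin θ /
        ((1 + l b y i) + (1 - l b y i) * Real.cos θ)))
      (fun i θ => ncpLift_add_two_pi (l b y i) θ) (hw1 b y))
    (fun b => measurable_ncpMixture_prod (hw b) (ha b) (hlm b) (ht b))
    (fun b => measurable_ncpMixtureJac_prod (hw b) (ha b) (hlm b))
    ψ hψ hψm hψsm hjac hS c hg n

end Layers

section Members

variable {ι : Type*} [Fintype ι]

/-- **FT-HMC as `latflow.fthmc` runs it, through a member given as a list of certified layers,
is exact.**  Layers `(F_k, J_k)` on `ι → U(1)`, each a measurable equivalence with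
`HasJacobian Haar^ι F_k (ofReal ∘ J_k)` and `J_k > 0` measurable; the member
`F = F_n ∘ ⋯ ∘ F_1` with the running-product Jacobian (`hasJacobian_foldr_trans`); the rest as in
`u1_fthmc_leapfrog_gaussian_exact`.  The reported configuration kernel leaves `e^{−S}·Haar^ι`
invariant. -/
theorem u1_fthmc_leapfrog_gaussian_exact_foldr
    (layers : List (((ι → Circle) ≃ᵐ (ι → Circle)) × ((ι → Circle) → ℝ)))
    (hpos : ∀ L ∈ layers, ∀ V, 0 < L.2 V) (hmeas : ∀ L ∈ layers, Measurable L.2)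
    (hjac : ∀ L ∈ layers,
      HasJacobian (Measure.pi fun _ : ι => haarProbability Circle) L.1
        fun V => ENNReal.ofReal (L.2 V))
    {S : (ι → Circle) → ℝ} (hS : Measurable S) (c : ℝ) {g : (ι → Circle) → (ι → ℝ)}
    (hg : Measurable g) (n : ℕ) :
    Invariant
      (conjKernel
        (refreshUpdate
          (involMH
            (⇑((flip : Equiv.Perm ((ι → Circle) × (ι → ℝ))) *
                leapfrog (mulDrift fun q : ι → ℝ => fun i => Circle.exp (c * q i)) g ^ n))
            (measurable_flip_leapfrog_pow (measurable_mulDrift (measurable_circleDrift c)) hg n)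
            fun z : (ι → Circle) × (ι → ℝ) =>
              (S (layers.foldr (fun L (G : (ι → Circle) ≃ᵐ (ι → Circle)) => L.1.trans G)
                  (MeasurableEquiv.refl (ι → Circle)) z.1) -
                Real.log (layers.foldr (fun L K => fun V => L.2 V * K (L.1 V))
                  (fun _ => (1 : ℝ)) z.1)) +
                ∑ i, z.2 i ^ 2 / 2)
          ((((volume : Measure (ι → ℝ)).withDensity
                fun q => ENNReal.ofReal (Real.exp (-(∑ i, q i ^ 2 / 2)))) Set.univ)⁻¹ •
            (volume : Measure (ι → ℝ)).withDensity
              fun q => ENNReal.ofReal (Real.exp (-(∑ i, q i ^ 2 / 2)))))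
        (layers.foldr (fun L (G : (ι → Circle) ≃ᵐ (ι → Circle)) => L.1.trans G)
          (MeasurableEquiv.refl (ι → Circle))))
      ((Measure.pi fun _ : ι => haarProbability Circle).withDensity
        fun U => ENNReal.ofReal (Real.exp (-S U))) := by
  obtain ⟨h0, hm, hJ⟩ := hasJacobian_foldr_trans layers hpos hmeas hjac
  exact u1_fthmc_leapfrog_gaussian_exact h0 hm hJ hS c hg n

end Members

end Summit.Ventures.LatticeQCDFlow.Exactness
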